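/-
Copyright: the b2b-balaban T⁴-continuum CRUX team, row NE7b OWNER lineage `t4-ne7b-p1` (gen 127). Project licence.
-/
import Summits.QuantumFields.BalabanUV.T4Continuum.Spine.NE7b.SupFibreGaussianIBP
import Summits.QuantumFields.BalabanUV.T4Continuum.Spine.NE7b.SupTorusFibreChart
import Summits.QuantumFields.BalabanUV.T4Continuum.Spine.NE7b.SupTorusFibreFluctuation

/-!
# THE TORUS INSTANCE: the Gaussian fluctuation measure of the road's linearised action AT ANY FIELD `φ` of the class, on (109)'s
# explicit chart of the zero-block-mean fibre of the fine torus `(ℤ∕(n+1)s)^d`, has as covariance THE INVERSE OF (101)'s FLUCTUATION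
# OPERATOR — `C·g` is the unique zero-mean field solving `Σ_x ((A_t h) x + u″(φ x)h x)κ x = Σ_x g x κ x` against every zero-mean `κ`
# (`torus_existsUnique_fibre_fluctuation`) — with mean zero, second moments `C(x,y)·Z`, and Gaussian integration by parts
# `∫ ⟨g,Pz⟩G(Pz)ρ = ∫ DG(Pz)(C·g)ρ`: (271)∕(272) discharged on the road's carriers, every `d, n, s ≥ 1, a`, `−λ ≤ u″∘φ`, `λ < min(2,a)`
# (row NE7b, node U5c; (101)∕(109)∕(271)∕(272) + (86)∕(89)∕(92) BY NAME; [folklore])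

Cell `pub-balaban`, sub-cell `t4`, spine estimate NE7b (`T4WeightBudget.RelWeightBound`; the cell's OWN estimate — NOT PRINTED in
[Bałaban 1983–89], NOT PROVED).  Crux-route work under `Spine/NE7b/` by the row OWNER (`t4-ne7b-p1` gen 127, file (274)) under FREEZE
(0)'s crux-prover clause, on § [NE7bP1-G126-HANDOFF] NEXT (3)(d) ((d1) ON THE TORUS); NOTHING of Bałaban's is named as a Lean object,
valued or asserted; no `T4Continuum/Support` leaf typed; no `def`, no notation; zero `sorry`.  Imports (BY NAME): the OWNER's (272)
`…SupFibreGaussianIBP` (`fibre_gaussian_ibp_covariance`; through it (271)), (109) `…SupTorusFibreChart` (`exists_fibreChart`), (101)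
`…SupTorusFibreFluctuation` (import closure: (92) `SupTorusEffectiveActionHessianFloor.response_form_floor`, (89)
`SupTorusDirichletFormCoercive.torus_operator_form_coercive`, (86) `SupTorusDirichletForm.torus_operator_form_symm`, (91)
`SupTorusEffectiveAction.exists_clm_pairForm`).

WHY (located).  (271)–(273) are stated at TEA's level for ANY symmetric form with a floor and ANY chart with a bound; this file checks
that the road supplies them: the form is `H_φ h k = Σ_x ((A_t h) x + u″(φ x)h x)k x` ((91)'s `exists_clm_pairForm`; symmetric by (86),
floor `min(2,a) − λ` by (89)+(92)), the chart is (109)'s (bound `1`, onto `ker Q′t`), so the Gaussian measure `e^{−½H_φ(Pz)(Pz)}dz` — the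
quadratic approximation AT `φ` of the road's fluctuation measure `e^{−S(Mw + Pz)}dz` ((121): equal to it when `S` is quadratic) — has a
covariance `C_φ`, and `C_φ` is the road's object: its columns are (101)'s unique fibre solutions.  This is the dictionary every later
cluster-expansion file on the torus quotes («the covariance of the fluctuation measure» = «the inverse of the fluctuation operator on the
fibre»), with the Gaussian calculus (moments, IBP) attached.

WHAT IS PROVED ([folklore]; the `Beta.Site` carriers, `A_t = Rf∘Aop∘Ef`, `Q′t = Rc∘Dop∘Ef` with their displayed actions):
* §1 `torus_linearised_form` (`∃ H_φ` with the displayed pairing, SYMMETRIC, floor `(min(2,a) − λ)Σh² ≤ H_φ h h`).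
* §2 THE END **`torus_fibre_gaussian_covariance`**: `−λ ≤ u″(φ x)`, `λ < min(2,a)` ⟹ `∃ P H_φ C`: (109)'s four chart clauses; the form's three
  clauses; `C` symmetric; for every source `g`, `C·g` has zero block means and solves (101)'s fibre equation, and every zero-mean solution IS
  `C·g`; `Z = ∫ e^{−½H_φ(Pz)(Pz)}dz > 0`; `∫ (Pz)_x ρ = 0`; `∫ (Pz)_x(Pz)_y ρ = C(x,y)·Z`; and for every bounded `C¹` `G` with bounded derivative
  `∫ ⟨g,Pz⟩G(Pz)ρ dz = ∫ DG(Pz)(C·g)ρ dz`.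
* §3 toy.

HONEST (what this is NOT).  One `obtain` on (272) after reading the road's form and chart; the FRD instance of (273) needs (109)'s chart
WITH its locality clause and `A_t` of range one in a torus distance (successor); cubic periods; the bound on `C_φ` (`(min(2,a) − λ)⁻¹` in
`ℓ²`, (101)) and its decay ((139)∕(169)) are not restated; nothing of the non-Gaussian fluctuation measure; scalar skeleton ((A3),
NC-NE7b-α UNRULED); nothing of Bałaban's asserted.  BY-NAME EFFECT ON THE WALL: NONE.  NE7b NOT PRINTED ∕ NOT PROVED; spine PROVED 0∕9; rung
(B)+1 on a FINITE torus — NOT infinite volume, NOT the mass gap, NOT Clay.  HONEST DEPENDENCY: continuum YM on T⁴ ⇐ BetaPertH ∧ nine spine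
estimates (0∕9 proved); BetaPertH ⇐ (D1) ∧ (D4) ∧ CAP+tail; G-an2-4 gates asym, D1 and NE2∕3∕4.
-/

set_option autoImplicit false

noncomputable section

namespace Summit.QuantumFields.BalabanUV.T4Continuum.NE7b.SupTorusFibreGaussianCovariance

open MeasureTheory Real
open scoped ENNReal
open Literature.MathematicalPhysics.QuantumFieldTheory.Balaban1983to89
open B6QGQLower276 (X B AX)
open B5Hk103ScalarZd (nbhd)
open Beta (Site siteOf windowMap)
open SupTorusDirichletForm (torus_operator_form_symm)
open SupTorusDirichletFormCoercive (torus_operator_form_coercive)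
open SupTorusEffectiveAction (exists_clm_pairForm)
open SupTorusEffectiveActionHessianFloor (response_form_floor)
open SupTorusFibreChart (exists_fibreChart)
open SupFibreGaussianIBP (fibre_gaussian_ibp_covariance)

variable {d : ℕ} (n : ℕ) (a : ℝ) (s : ℕ) [NeZero s]
  {Dop Aop : lp (fun _ : X d => ℝ) ∞ →L[ℝ] lp (fun _ : X d => ℝ) ∞}
  (hA : ∀ (f : lp (fun _ : X d => ℝ) ∞) (p : X d), Aop f p = ∑ r ∈ nbhd n p, AX n a p r * f r)
  (hD : ∀ (f : lp (fun _ : X d => ℝ) ∞) (y : X d), Dop f y = (((n : ℝ) + 1) ^ d)⁻¹ * ∑ p ∈ B n y, f p)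
  {Ef : (Site d ((n + 1) * s) → ℝ) →L[ℝ] lp (fun _ : X d => ℝ) ∞}
  (hEf : ∀ (g : Site d ((n + 1) * s) → ℝ) (q : X d), Ef g q = g (siteOf d ((n + 1) * s) q))
  {Rf : lp (fun _ : X d => ℝ) ∞ →L[ℝ] (Site d ((n + 1) * s) → ℝ)}
  (hRf : ∀ (h : lp (fun _ : X d => ℝ) ∞) (x : Site d ((n + 1) * s)), Rf h x = h (windowMap d ((n + 1) * s) x))
  {Rc : lp (fun _ : X d => ℝ) ∞ →L[ℝ] (Site d s → ℝ)}
  (hRc : ∀ (h : lp (fun _ : X d => ℝ) ∞) (x : Site d s), Rc h x = h (windowMap d s x))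

/-! ## §1. The road's linearised form at a field: symmetric, with the floor -/

include hA hEf hRf in
/-- **THE LINEARISED FORM AT `φ`**: `∃ H_φ` continuous bilinear with `H_φ h k = Σ_x ((A_t h) x + u″(φ x)h x)k x`, symmetric ((86)), and with
the floor `(min(2,a) − λ)Σh² ≤ H_φ h h` whenever `−λ ≤ u″(φ x)` at every site ((89)+(92)). [folklore] -/
theorem torus_linearised_form {u' : ℝ → ℝ} {lam : ℝ} {φ : Site d ((n + 1) * s) → ℝ} (hu' : ∀ x, -lam ≤ u' (φ x)) :
    ∃ Hφ : (Site d ((n + 1) * s) → ℝ) →L[ℝ] (Site d ((n + 1) * s) → ℝ) →L[ℝ] ℝ,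
      (∀ h k, Hφ h k = ∑ x, (((Rf.comp Aop).comp Ef) h x + u' (φ x) * h x) * k x) ∧
      (∀ h k, Hφ h k = Hφ k h) ∧
      (∀ h, (min 2 a - lam) * ∑ x, h x ^ 2 ≤ Hφ h h) := by
  obtain ⟨Hφ, hH⟩ := exists_clm_pairForm ((Rf.comp Aop).comp Ef) (fun x => u' (φ x))
  refine ⟨Hφ, hH, fun h k => ?_, fun h => ?_⟩
  · rw [hH, hH]
    have hs := torus_operator_form_symm n a s hA hEf hRf h k
    have e1 : ∑ x, (((Rf.comp Aop).comp Ef) h x + u' (φ x) * h x) * k x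
        = ∑ x, k x * ((Rf.comp Aop).comp Ef) h x + ∑ x, u' (φ x) * h x * k x := by
      rw [← Finset.sum_add_distrib]; exact Finset.sum_congr rfl fun x _ => by ring
    have e2 : ∑ x, (((Rf.comp Aop).comp Ef) k x + u' (φ x) * k x) * h x
        = ∑ x, h x * ((Rf.comp Aop).comp Ef) k x + ∑ x, u' (φ x) * h x * k x := by
      rw [← Finset.sum_add_distrib]; exact Finset.sum_congr rfl fun x _ => by ring
    rw [e1, e2, hs]
  · rw [hH]
    exact response_form_floor ((Rf.comp Aop).comp Ef) (torus_operator_form_coercive n a s hA hEf hRf) hu' h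

/-! ## §2. THE END: the Gaussian fluctuation measure on the torus fibre and its covariance -/

include hA hD hEf hRf hRc in
/-- **HEADLINE — THE TORUS INSTANCE OF (271)∕(272).**  `−λ ≤ u″(φ x)` at every fine torus site, `λ < min(2,a)` ⟹ `∃ P H_φ C`: `P` is (109)'s
chart of the zero-block-mean fields (`Q′t∘P = 0`, `Σζ² ≤ Σ(Pζ)² ≤ ((n+1)^d + 1)Σζ²`, onto `ker Q′t`); `H_φ` the road's linearised form at `φ`
(displayed pairing, symmetric, floor `min(2,a) − λ`); `C` symmetric; for EVERY source `g` the field `C·g` has zero block means and solves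
(101)'s fibre equation `Σ_x ((A_t(C·g)) x + u″(φ x)(C·g) x)κ x = Σ_x g x κ x` for all zero-mean `κ`, and every zero-mean solution is `C·g`; and
the Gaussian measure `ρ dz = e^{−½H_φ(Pz)(Pz)}dz` has `Z > 0`, mean zero, second moments `C(x,y)·Z`, and the integration-by-parts identity
`∫ ⟨g,Pz⟩G(Pz)ρ = ∫ DG(Pz)(C·g)ρ` for bounded `C¹` `G` with bounded derivative. [folklore] -/
theorem torus_fibre_gaussian_covariance {u' : ℝ → ℝ} {lam : ℝ} {φ : Site d ((n + 1) * s) → ℝ} (hu' : ∀ x, -lam ≤ u' (φ x))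
    (hγ : lam < min 2 a) :
    ∃ (P : ((Site d s × {z : Fin d → Fin (n + 1) // z ≠ 0}) → ℝ) →L[ℝ] (Site d ((n + 1) * s) → ℝ))
      (Hφ : (Site d ((n + 1) * s) → ℝ) →L[ℝ] (Site d ((n + 1) * s) → ℝ) →L[ℝ] ℝ)
      (C : Site d ((n + 1) * s) → Site d ((n + 1) * s) → ℝ),
      -- the chart ((109))
      (∀ ζ, ((Rc.comp Dop).comp Ef) (P ζ) = 0) ∧
      (∀ ζ, (1 : ℝ) * ∑ i, ζ i ^ 2 ≤ ∑ x, P ζ x ^ 2) ∧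
      (∀ ζ, ∑ x, P ζ x ^ 2 ≤ (((n : ℝ) + 1) ^ d + 1) * ∑ i, ζ i ^ 2) ∧
      (∀ h : Site d ((n + 1) * s) → ℝ, ((Rc.comp Dop).comp Ef) h = 0 → ∃ ζ, P ζ = h) ∧
      -- the form
      (∀ h k, Hφ h k = ∑ x, (((Rf.comp Aop).comp Ef) h x + u' (φ x) * h x) * k x) ∧
      (∀ h k, Hφ h k = Hφ k h) ∧
      (∀ h, (min 2 a - lam) * ∑ x, h x ^ 2 ≤ Hφ h h) ∧
      -- the covariance: symmetric; THE inverse of the fluctuation operator on the fibre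
      (∀ x y, C x y = C y x) ∧
      (∀ g : Site d ((n + 1) * s) → ℝ,
        ((Rc.comp Dop).comp Ef) (fun x => ∑ y, C x y * g y) = 0 ∧
        ∀ κ : Site d ((n + 1) * s) → ℝ, ((Rc.comp Dop).comp Ef) κ = 0 →
          ∑ x, (((Rf.comp Aop).comp Ef) (fun x' => ∑ y, C x' y * g y) x + u' (φ x) * ∑ y, C x y * g y) * κ x = ∑ x, g x * κ x) ∧
      (∀ g h : Site d ((n + 1) * s) → ℝ, ((Rc.comp Dop).comp Ef) h = 0 →
        (∀ κ : Site d ((n + 1) * s) → ℝ, ((Rc.comp Dop).comp Ef) κ = 0 →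
          ∑ x, (((Rf.comp Aop).comp Ef) h x + u' (φ x) * h x) * κ x = ∑ x, g x * κ x) →
        h = fun x => ∑ y, C x y * g y) ∧
      -- the Gaussian fluctuation measure in the chart
      0 < ∫ z, exp (-((1 / 2 : ℝ) * Hφ (P z) (P z))) ∧
      (∀ x, ∫ z, P z x * exp (-((1 / 2 : ℝ) * Hφ (P z) (P z))) = 0) ∧
      (∀ x y, ∫ z, P z x * P z y * exp (-((1 / 2 : ℝ) * Hφ (P z) (P z)))
        = C x y * ∫ z, exp (-((1 / 2 : ℝ) * Hφ (P z) (P z)))) ∧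
      (∀ (G : (Site d ((n + 1) * s) → ℝ) → ℝ) (C₀ C₁ : ℝ), ContDiff ℝ 1 G → (∀ v, ‖G v‖ ≤ C₀) → (∀ v, ‖fderiv ℝ G v‖ ≤ C₁) →
        ∀ g : Site d ((n + 1) * s) → ℝ,
          ∫ z, (∑ x, g x * P z x) * G (P z) * exp (-((1 / 2 : ℝ) * Hφ (P z) (P z)))
            = ∫ z, fderiv ℝ G (P z) (fun x => ∑ y, C x y * g y) * exp (-((1 / 2 : ℝ) * Hφ (P z) (P z)))) := by
  classical
  obtain ⟨P, hQP, hPlow, hPup, hPsurj⟩ := exists_fibreChart n s hD hEf hRc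
  obtain ⟨Hφ, hH, hHsym, hfl⟩ := torus_linearised_form n a s hA hEf hRf hu'
  obtain ⟨C, hCsym, hCfib, hCuniq, hZ, hmean, hsecond, hibp⟩ :=
    fibre_gaussian_ibp_covariance P hHsym hfl (sub_pos.2 hγ) hPlow one_pos
  refine ⟨P, Hφ, C, hQP, hPlow, hPup, hPsurj, hH, hHsym, hfl, hCsym, fun g => ?_, fun g h hh hsol => ?_, hZ, hmean, hsecond, hibp⟩
  · -- `C·g` is in the fibre and solves the road's fibre equation
    obtain ⟨⟨w, hw⟩, hfib⟩ := hCfib g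
    refine ⟨by rw [← hw]; exact hQP w, fun κ hκ => ?_⟩
    obtain ⟨ζ, rfl⟩ := hPsurj κ hκ
    rw [← hH, hfib ζ]
  · -- every zero-mean solution is `C·g`
    obtain ⟨ζ₀, hζ₀⟩ := hPsurj h hh
    exact hCuniq g h ⟨ζ₀, hζ₀⟩ fun ζ => by rw [hH]; exact hsol (P ζ) (hQP ζ)

/-! ## §3. Toy -/

/-- Toy: the floor modulus of §1 is positive exactly in the road's regime `λ < min(2,a)`. -/
example {lam a : ℝ} (h : lam < min 2 a) : 0 < min 2 a - lam := sub_pos.2 h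

end Summit.QuantumFields.BalabanUV.T4Continuum.NE7b.SupTorusFibreGaussianCovariance
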